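import Mathlib
import HarnessLib
import Literature.Geometry.Lorentzian.Hintz2026.IndicialRoots

/-!
# Hintz 2026, Lemma 8.15 (`LemmaWE0Pair`), proof part (2): the "direct computation" of the vector-type-1 pairing
# (EqWE0Pairv1) — kernel reproduction; and the Gluing I / Gluing III / Hintz-2026 normalisations of the cokernel
# pairings side by side

#harness_tags [topic Geometry/Lorentzian]

CITATION HEADER (lean-in-tree rule 2026-08-18).  P. Hintz, *Nonlinear stability of subextremal Kerr black holes*,
arXiv:2606.28253 **v2** (2026-08-03), bib key `Hintz2026` — an UNREFEREED CLAIM under adjudication in this library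
(`Literature.Geometry.Lorentzian.hintz_kerr_stability_subextremal_cauchy` carries its main theorem as
`@[claim "Hintz2026" "under-review"]`); TeX line numbers `H l.N` refer to the v2 source `kerr-stab-r.tex`
(md5 2c6513182847), display numbers to the v2 PDF.  Secondary sources (both UNREFEREED preprints by the same author,
recorded for what they PRINT): "GI" = P. Hintz, *Gluing small black holes along timelike geodesics I: formal solution*,
arXiv:2306.07409, bib key `Hintz2023GluingI` (TeX `glueloc-r.tex` of the public e-print, "GI l.N"; PDF page numbers of the
public PDF), and "GIII" = P. Hintz, *Gluing small black holes along timelike geodesics III*, arXiv:2408.06715, bib key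
`Hintz2024GluingIII`.  Written by the audit cell
`pub-kerr` (HINTZ-PLAN.md P33, the Gluing-I/II interface of Hintz 2026); nothing in this file is a stability statement
or an estimate — it is arithmetic about explicitly printed matrices and vectors, and it REUSES (by import, not by
re-declaration) the cell's transcription `IndicialRoots.N2Lv1` of the vector-type-1 block of `2·\hat{\ubar L}(0)`
(eq. `EqWEOpMink0`, H l.7324–7353), which two independent engines of the cell had already confirmed.

## What is printed

Lemma `LemmaWE0Pair` (H l.7968–7992; v2 PDF Lemma 8.15), item (2) (`ItWE0Pair2v1`), eq. (EqWE0Pairv1) (H l.7988–7991):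
`⟨L̂_b(0) h̆¹_{b,v1}(𝕍), h*_{b,v1}(𝕍′)⟩_{L²} = −8π𝔪 ⟨𝔞(𝕍), 𝔞(b) × 𝔞(𝕍′)⟩_{ℝ³}`.  The proof (H l.8003–8046) gives TWO
arguments.  (i) CONCEPTUAL (H l.8003–8011): by (EqWEMode0Ang) (H l.7823, `ġ^Υ_b(0,ȧ) = −2 h_{b,v1}(𝕍(v))`, `ȧ = v × 𝔞`)
the left side is `½⟨[L_b,t_*]ġ^Υ_b(0, v×𝔞), h*_{b,v1}(𝕍′)⟩`, and Lemma `LemmaWEPair` (H l.7887–7912; v2 PDF Lemma 8.12;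
"The proof of [GIII, Lemma 3.17] applies verbatim", which "in turn builds on [GI, Theorem 9.6]", H l.7885) gives
`⟨[L_b,t_*]ġ^Υ_b(0,ȧ), h*_{b,v1}(𝕍(𝔮))⟩ = −16π𝔪(𝔮·ȧ)`, whence `−8π𝔪⟨𝔞(𝕍′), v×𝔞⟩`.  (ii) DIRECT (H l.8013–8046): by a
boundary-pairing computation "(The form of this expression is a special case of [GI, Lemma 2.5])" the left side equals
(display H l.8041–8045)
`−(8π/3)⟨𝔞(𝕍), 𝔞(b)×𝔞(𝕍′)⟩ · ¼ · (−𝔪/(1+2v^𝓒γ^𝓒)) · ∂_λN_{v1}(ρ^{−2}L̂_b(0),λ)|_{λ=−1}(1+γ^Υ/2, 1−γ^Υ/2) [[0,−4],[−4,0]] (1+(2v^𝓒−1)γ^𝓒, 1+(2v^𝓒+1)γ^𝓒)ᵀ`,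
"After a short computation, this gives (EqWE0Pairv1)."  READING (v2 of this file; audit datum SRC-A38, REFEREE #64 precision
P29): the display prints its four factors in the token order `∂_λN|_{λ=−1} · (1+γ^Υ/2, 1−γ^Υ/2) · [[0,−4],[−4,0]] · column`; this
file transcribes it — `printedExpression` — in the reading FIXED BY THE PAPER'S OWN PARENTHESIS, GI Lemma 2.5 (`LemmaBgBdyPair`,
GI l.1689–1711; eq. (2.8) `EqBgBdyPair` GI l.1702–1709, case `k = 0` = GI l.1707): `lim_{ε↘0}⟨[L,χ_ε]u, v*⟩ = ⟨∂_λN(x^αL,z)u₀, v₀*⟩_{L²(∂X,ν(0))}` "mutatis mutandis … fiber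
inner products", i.e. the indicial derivative acts on the KERNEL datum `u₀ = (1+γ^Υ/2, 1−γ^Υ/2)` (the leading term of `h̆¹`) and
the result is paired, through the fibre form `[[0,−4],[−4,0]]`, with the COKERNEL datum `v₀*` (the column vector): `⟨∂_λN·u₀, F·v₀*⟩`.
Read instead as a literal matrix product `row · ∂_λN · F · column = ⟨(∂_λN)ᵀu₀, F v₀*⟩` (the transpose on the other side —
`∂_λN` is not symmetric), the display does NOT give (EqWE0Pairv1): `core_identity_literal`, `literal_sub_lemma25`,
`literal_reading_witness` (at `(v^𝓒,γ^𝓒,γ^Υ) = (0,1,1)` the two cores are `−24` vs `−72`, the two expressions `−8π𝔪T` vs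
`−24π𝔪T`).  So "as printed"/"transcription" below always means: the printed factors, assembled per GI Lemma 2.5 as the paper
says; NIL for every result (the Lemma-2.5 reading reproduces (EqWE0Pairv1) exactly and agrees with the conceptual argument (i)).
Its inputs, as printed: `2N_{v1}(ρ^{−2}L̂(0),λ) ≡ −λ²+λ +
λγ^𝓒[[1−v^𝓒, −(1−v^𝓒)],[1+v^𝓒, −(1+v^𝓒)]] + λγ^Υ[[−1,−1],[1,1]]` modulo λ-independent terms (H l.8026–8028);
`ρ ū h¹_{v1}(𝕍) = ¼(1+γ^Υ/2, 1−γ^Υ/2)` w.r.t. `𝕍` (H l.8030 = eq. (EqWG0Largev1m1hbar), H l.6577–6579);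
`ρ^{−2} ū h♯_{v1}(w) = −𝔪/(1+2v^𝓒γ^𝓒) · (1+2(v^𝓒−1)γ^𝓒, 1+2(v^𝓒+1)γ^𝓒)` w.r.t. `𝕍(w)` (H l.8031 = eq. (EqWC0hbv1Lead),
H l.7022–7025); the fibre inner product of `v1` tensors in the slots `(2dx̲⁰⊗_s ·, 2dx̲¹⊗_s ·)` is `[[0,−4],[−4,0]]`
(H l.8034–8037); and `∫_{𝕊²}⟨d̸𝖲(𝔞(𝕍)), d̸𝖲(w)⟩ = (8π/3)⟨𝔞(𝕍), w⟩` (H l.8039).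

## What is proved here (`v = v^𝓒`, `γC = γ^𝓒`, `γU = γ^Υ`; all over `ℝ`, for ALL parameter values unless stated)

1. `taylor_N2Lv1` : `dN2Lv1` is the λ-derivative of `IndicialRoots.N2Lv1` (exact quadratic Taylor identity), and its
   printed λ-linear part (`printed_linear_part`) is the one displayed at H l.8026–8028.
2. `hOne_mem_ker` : `N_{v1}(2L̂(0), −1)·(1+γU/2, 1−γU/2)ᵀ = 0` — the leading term (EqWG0Largev1m1hbar) IS an indicial
   solution at the printed root `−1` ("comprise the space `ker N_{v1}(L̂(0),−1)`", H l.6575), for every `(v, γC, γU)`.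
3. `hSharp_mem_coker` : the vector (EqWC0hbv1Lead) is in the DUAL kernel at the weight GI Lemma 2.5 assigns to it:
   `N_{v1}(2L̂(0),−1)ᵀ · F · (1+2(v−1)γC, 1+2(v+1)γC)ᵀ = 0` for every `(v, γC, γU)` (`lemma25_orders`: with `x = ρ`,
   density `ρ^{−3}×`b-density (`w = 3`, H l.8021), `L̂(0) ∈ ρ²Diff_b` (`α = −2`), `u = h̆¹ ∼ ρ^{−1}` (`z = −1`), GI
   Lemma 2.5's dual order `−z̄+α+w` is `2` = the order of `h♯`, and the indicial point is `λ = z = −1`).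
   `hSharpAlt_defect` : the vector printed in the final display H l.8044, `(1+(2v−1)γC, 1+(2v+1)γC)`, is NOT:
   its defect is `8γC(1+2vγC)·(2−γU, −(2+γU))` — so "(2v^𝓒∓1)γ^𝓒" at l.8044 is a slip for the "2(v^𝓒∓1)γ^𝓒" of
   (EqWC0hbv1Lead) and of the proof's own recall of it (H l.8031); audit datum SRC-A37, NIL.
4. `core_identity` : `⟨∂_λN_{v1}(2L̂(0),λ)|_{−1}(1+γU/2, 1−γU/2)ᵀ, F(1+2(v−1)γC, 1+2(v+1)γC)ᵀ⟩ = −24(1+2vγC)` —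
   `γU` DROPS OUT identically — hence (`direct_computation`) the printed expression of H l.8041–8045 (with `N = ½·2N`
   and the (EqWC0hbv1Lead) vector) equals `−8π𝔪⟨𝔞(𝕍), 𝔞(b)×𝔞(𝕍′)⟩` EXACTLY whenever `1+2vγC ≠ 0`: the paper's "short
   computation" holds.  With the l.8044 vector instead the value is `−8π𝔪⟨…⟩·(1 + γ^𝓒γ^Υ/6)` (`direct_computation_alt`).
   With the LITERAL token order (transpose on `u₀`'s side) the core is `−24(1+2vγC) + 8(γC+γU)(γU−4γC+2vγCγU)`
   (`core_identity_literal`), `γU`-dependent, and the expression is `−24π𝔪T` at `(0,1,1)` (`literal_reading_witness`,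
   `literalExpression_witness`) — the GI-Lemma-2.5 reading is the operative one (v2; SRC-A38, NIL).
5. `conceptual_eq_direct` : the two arguments agree — `½·(−16π𝔪 q) = −8π𝔪 q` — i.e. the value `−16π𝔪(𝔮·ȧ)` that
   Lemma 8.12 imports from GIII Lemma 3.17 is CONSISTENT, for Hintz 2026's own operator `L_b = D_{g_b}Ric + δ*δ𝖦`
   (H l.7249, eq. (EqWEOp); factor ONE in front of `D Ric`), with an independent boundary-pairing computation in the
   paper's own conventions.  `hLemma812_eq_two_smul_giThm96` records the PRINTED tables: GI Theorem 9.6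
   (`ThmAhKCoker`, GI l.4899–4952, public PDF p.129; pairings `⟨D_{ĝ_b}Ric(t̂_* ĝ′_b(ḃ)), 𝖦δ*ω*⟩`) prints
   `−8π𝔪̇, −8π(𝔮·𝔞)𝔪̇, 0 / 0, −8π𝔪(𝔮·ȧ), 0 / 0, 0, 4π𝔪(𝔮·ĉ)`, exactly HALF of GIII Lemma 3.17 = Hintz Lemma 8.12
   (`−16π𝔪̇, …, 8π𝔪(𝔮·c)`), entry by entry; GIII's proof (arXiv:2408.06715, p.37: "We may thus replace `L` by
   `2D_{ĝ_b}Ric` … The pairings of interest are thus equal to twice [those] computed in Theorem [GI 9.6]") prints the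
   factor.  Which of GIII's conventions carries that 2 relative to Hintz 2026's `L_b` is NOT adjudicated here (T4
   reading of GIII); what IS certified is item 4: in Hintz 2026's conventions the `v1`/`ȧ` entry `−16π𝔪` is the right one.
6. `eqWC0VV_at_height` (+ `sphereAvg_heightSq`) : GI's explicit example after GI (6.1) (GI l.3040–3041, PDF p.71:
   for `𝕍 = sin²θ dφ`, `𝕍⊗_s𝕍 = ⅓g̸ + (Y g̸ + δ̸₀*d̸Y)`, `Y = ½sin²θ − ⅓`) is the instance `𝖲 = cos θ` of Hintz's general
   claim (EqWC0VV) (H l.7120–7124: `𝕍⊗_s𝕍 = (avg 𝖲²) g̸ + (Y(𝖲)g̸ + δ̸₀*d̸Y(𝖲))`, `Y(𝖲) = ½(avg 𝖲² − 𝖲²)`), which Hintz cites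
   "[GI, (6.1)]" for (H l.7116) and on which the derivation of (EqWC0hbv1Lead) rests (proof of Prop. `PropWC0hbv1`):
   `avg cos² = ⅓` (as a `[0,π]`-integral), `Y(cos θ) = ½sin²θ − ⅓`, and the two tensor components `θθ`, `φφ` of the
   identity, with the Hessian of `Y` on the round sphere computed from the actual first and second derivatives of `Y`.

Audit-cell findings recorded with this file (DIVERGENCE.md, all NIL): SRC-A36 (H l.3208, display (2.35): "δ̸*(δ̸₀*d̸𝖲)"
printed for "δ̸(δ̸₀*d̸𝖲)" in the recall of GI Lemma 6.4 — GI (6.3) prints the divergence; the cell's engines and this file's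
item 2–4 inputs use the divergence), EXT-G12 (GI (6.2), GI l.3048 = PDF p.71: "Δ̸(d̸𝖲) = (l(l+1)−1)𝖲" for "…d̸𝖲"; Hintz's
recall H l.3207 prints the 1-form), SRC-A37 (item 3), SRC-A38 (v2: the reading of the l.8041–8045 display, item 4 and §4b;
proposed by REFEREE #64 as precision P29).  [cite: Hintz2026, Lemma `LemmaWE0Pair` proof, TeX l.8013-8046;
eq. `EqWG0Largev1m1hbar` l.6577; eq. `EqWC0hbv1Lead` l.7022; eq. `EqWEMode0Ang` l.7823; Lemma `LemmaWEPair` l.7887-7912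
(claims under review)] [cite: Hintz2023GluingI, Thm 9.6 `ThmAhKCoker`, Lemma 2.5 `LemmaBgBdyPair`, eq. (6.1) and
the example following it (preprint)] [cite: Hintz2024GluingIII, Lemma 3.17 and its proof p.37 (preprint)]
-/

open Matrix Real

noncomputable section

namespace Literature.Geometry.Lorentzian.Hintz2026.VectorTypeOnePairing

open Literature.Geometry.Lorentzian.Hintz2026.IndicialRoots (N2Lv1)

/-! ## 1. Transcriptions (the five printed inputs of the "direct computation") -/

/-- `ρ·ū h¹_{v1}(𝕍)` without the overall `¼`: `(1 + γ^Υ/2, 1 − γ^Υ/2)` in the slots `(0∠, 1∠)` w.r.t. `𝕍`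
(eq. `EqWG0Largev1m1hbar`, H l.6577–6579; recalled H l.8030). [cite: Hintz2026, eq. EqWG0Largev1m1hbar, TeX l.6577-6579 (transcription)] -/
def hOne (γU : ℝ) : Fin 2 → ℝ := ![1 + γU / 2, 1 - γU / 2]

/-- `ρ^{−2}·ū h♯_{v1}(w)` without the prefactor `−𝔪/(1+2v^𝓒γ^𝓒)`: `(1 + 2(v^𝓒−1)γ^𝓒, 1 + 2(v^𝓒+1)γ^𝓒)` in the slots
`(dx̲⁰, dx̲¹) ⊗_s ρ𝕍(w)` (eq. `EqWC0hbv1Lead`, H l.7022–7025; recalled verbatim H l.8031).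
[cite: Hintz2026, eq. EqWC0hbv1Lead, TeX l.7022-7025 (transcription)] -/
def hSharp (v γC : ℝ) : Fin 2 → ℝ := ![1 + 2 * (v - 1) * γC, 1 + 2 * (v + 1) * γC]

/-- The vector as printed in the FINAL display of the proof, H l.8044: `(1 + (2v^𝓒−1)γ^𝓒, 1 + (2v^𝓒+1)γ^𝓒)` —
`(2v∓1)γC` where (EqWC0hbv1Lead) (H l.7022–7025) and the proof's own recall (H l.8031) have `2(v∓1)γC = (2v∓2)γC`;
the difference is `γC·(1, −1)` (audit datum SRC-A37; see `hSharpAlt_defect`, `direct_computation_alt`).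
[cite: Hintz2026, proof of Lemma LemmaWE0Pair, final display, TeX l.8044 (transcription)] -/
def hSharpAlt (v γC : ℝ) : Fin 2 → ℝ := ![1 + (2 * v - 1) * γC, 1 + (2 * v + 1) * γC]

/-- The two printed vectors differ by `γC·(1, −1)`. [cite: Hintz2026, TeX l.8031 vs l.8044 (audit datum SRC-A37)] -/
theorem hSharpAlt_sub_hSharp (v γC : ℝ) : hSharpAlt v γC - hSharp v γC = γC • ![1, -1] := by
  ext i; fin_cases i <;> simp [hSharpAlt, hSharp] <;> ring

/-- Fibre inner product of vector-type-1 tensors in the slots `(2dx̲⁰⊗_s η, 2dx̲¹⊗_s η′)`: "the Minkowskian inner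
product of `2dx̲⁰⊗_sη` and `2dx̲¹⊗_sη′` is `−4⟨η,η′⟩`", matrix `[[0,−4],[−4,0]]` (H l.8034–8037; = the `(0∠,1∠)` block
of GI (6.8) `EqMkMinkInner`, GI l.3149–3152). [cite: Hintz2026, proof of Lemma LemmaWE0Pair, TeX l.8034-8037; Hintz2023GluingI, eq. (6.8) (transcription)] -/
def Fv1 : Matrix (Fin 2) (Fin 2) ℝ := !![0, -4; -4, 0]

/-- `∂_λ N_{v1}(ρ^{−2}·2\hat{\ubar L}(0), λ)`: the entrywise λ-derivative of `IndicialRoots.N2Lv1` (proved to be the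
derivative in `taylor_N2Lv1`); the display H l.8044 uses `∂_λN_{v1}(ρ^{−2}L̂_b(0),λ)|_{λ=−1}` = ½ of this at `λ = −1`.
[cite: Hintz2026, proof of Lemma LemmaWE0Pair, TeX l.8044; eq. EqWEOpMink0 l.7324-7353 (derivative of the transcription)] -/
def dN2Lv1 (v γC γU lam : ℝ) : Matrix (Fin 2) (Fin 2) ℝ :=
  !![-2 * lam + 1 + γC * (1 - v) - γU, -γC * (1 - v) - γU;
     γC * (1 + v) + γU, -2 * lam + 1 - γC * (1 + v) + γU]

/-- Exact quadratic Taylor identity: `N2Lv1(λ+h) = N2Lv1(λ) + h·dN2Lv1(λ) − h²·1`, so `dN2Lv1(λ)` is the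
λ-derivative of the (entrywise quadratic) family `N2Lv1`. [cite: Hintz2026, eq. EqWEOpMink0 TeX l.7324-7353 (algebra on the transcription)] -/
theorem taylor_N2Lv1 (v γC γU lam h : ℝ) :
    N2Lv1 v γC γU (lam + h) = N2Lv1 v γC γU lam + h • dN2Lv1 v γC γU lam - (h ^ 2) • (1 : Matrix (Fin 2) (Fin 2) ℝ) := by
  ext i j
  fin_cases i <;> fin_cases j <;> simp [N2Lv1, dN2Lv1] <;> ring

/-- The printed λ-linear part (H l.8026–8028): `2N_{v1} ≡ (−λ²+λ)·1 + λγC[[1−v, −(1−v)],[1+v, −(1+v)]] +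
λγU[[−1,−1],[1,1]]` modulo λ-independent terms — i.e. `N2Lv1(λ) − N2Lv1(0)` is exactly that.
[cite: Hintz2026, proof of Lemma LemmaWE0Pair, display TeX l.8026-8028] -/
theorem printed_linear_part (v γC γU lam : ℝ) :
    N2Lv1 v γC γU lam - N2Lv1 v γC γU 0 =
      (-lam ^ 2 + lam) • (1 : Matrix (Fin 2) (Fin 2) ℝ)
        + (lam * γC) • !![1 - v, -(1 - v); 1 + v, -(1 + v)] + (lam * γU) • !![-1, -1; 1, 1] := by
  ext i j
  fin_cases i <;> fin_cases j <;> simp [N2Lv1] <;> ring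

/-! ## 2. The leading term of `h̆¹_{v1}` is an indicial solution at `λ = −1` -/

/-- (EqWG0Largev1m1hbar) lies in `ker N_{v1}(2L̂(0), −1)` identically in `(v, γC, γU)` ("The leading-order terms
`ū h¹_{v1}(𝕍)` … comprise the space `ker N_{v1}(L̂(0),−1)`", H l.6575). [cite: Hintz2026, Prop. PropWG0Large item (v1,−1), TeX l.6570-6579 (claim under review; verified here for the transcribed matrices)] -/
theorem hOne_mem_ker (v γC γU : ℝ) : (N2Lv1 v γC γU (-1)).mulVec (hOne γU) = 0 := by
  ext i
  fin_cases i <;> simp [N2Lv1, hOne, Matrix.mulVec, dotProduct, Fin.sum_univ_two] <;> ring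

/-! ## 3. The leading term of `h♯_{v1}` is a dual indicial solution at the weight GI Lemma 2.5 assigns -/

/-- GI Lemma 2.5 (`LemmaBgBdyPair`, GI l.1689–1711, proof from l.1712; public PDF p.29) bookkeeping at Hintz's use site (H l.8021–8024):
boundary defining function `x = ρ`; density `ρ^{−3} ×` b-density, i.e. `w = 3`; `L̂_b(0) ∈ ρ² Diff_b`, i.e.
`L ∈ x^{−α}Diff_b` with `α = −2`; `u = h̆¹_{v1} ∈ 𝒜^{−1}`, i.e. `z = −1`.  GI's hypothesis on the dual solution is
`v* ∈ x^{−z̄+α+w}C^∞ + …`, and `−z+α+w = 2` — exactly the order `ρ²` of `h♯_{v1}` (Prop. `PropWC0hbv1`(1), H l.7019);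
the indicial family is evaluated at `λ = z = −1`, as printed ("∂_λN…|_{λ=−1}", H l.8044), and `N(x^αL,λ) =
N(ρ^{−2}L̂(0),λ)` is the family the display names.  Pure integer bookkeeping. [cite: Hintz2023GluingI, Lemma 2.5 `LemmaBgBdyPair`; Hintz2026, TeX l.8019-8024 and l.8044] -/
theorem lemma25_orders : (-(-1 : ℤ)) + (-2) + 3 = 2 ∧ (2 : ℤ) + (-1) + 2 - 3 = 0 := by norm_num

/-- (EqWC0hbv1Lead) is `Fv1`-dual to the whole range of `N_{v1}(2L̂(0),−1)`: `N(−1)ᵀ·(F·h♯) = 0`, identically.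
[cite: Hintz2026, Prop. PropWC0hbv1 eq. EqWC0hbv1Lead TeX l.7022-7025 (claim under review; verified here for the transcribed matrices)] -/
theorem hSharp_mem_coker (v γC γU : ℝ) :
    (N2Lv1 v γC γU (-1)).transpose.mulVec (Fv1.mulVec (hSharp v γC)) = 0 := by
  ext i
  fin_cases i <;>
    simp [N2Lv1, hSharp, Fv1, Matrix.mulVec, dotProduct, Fin.sum_univ_two, Matrix.transpose_apply] <;> ring

/-- Equivalent pairing form: `⟨N(−1)x, F h♯⟩ = 0` for every `x`. [cite: Hintz2026, eq. EqWC0hbv1Lead TeX l.7022-7025 (as above)] -/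
theorem hSharp_pairing_vanishes (v γC γU : ℝ) (x : Fin 2 → ℝ) :
    dotProduct ((N2Lv1 v γC γU (-1)).mulVec x) (Fv1.mulVec (hSharp v γC)) = 0 := by
  simp [N2Lv1, hSharp, Fv1, Matrix.mulVec, dotProduct, Fin.sum_univ_two]
  ring

/-- The l.8044 vector is NOT dual: its defect is `8γC(1+2vγC)·(2−γU, −(2+γU))`.
[cite: Hintz2026, TeX l.8044 vs l.8031 / l.7022-7025 (audit datum SRC-A37)] -/
theorem hSharpAlt_defect (v γC γU : ℝ) :
    (N2Lv1 v γC γU (-1)).transpose.mulVec (Fv1.mulVec (hSharpAlt v γC)) =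
      (8 * γC * (1 + 2 * v * γC)) • ![2 - γU, -(2 + γU)] := by
  ext i
  fin_cases i <;>
    simp [N2Lv1, hSharpAlt, Fv1, Matrix.mulVec, dotProduct, Fin.sum_univ_two, Matrix.transpose_apply] <;> ring

/-- Hence whenever `γC ≠ 0` and `1 + 2vγC ≠ 0` (e.g. the standing regime `γC > 0` small, `v ∈ (0,1)`) the l.8044 vector
fails the duality (the vector `(2−γU, −(2+γU))` never vanishes), while the (EqWC0hbv1Lead) vector passes it for ALL
parameters (`hSharp_mem_coker`). [cite: Hintz2026, TeX l.8044 vs l.8031 (audit datum SRC-A37)] -/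
theorem hSharpAlt_not_coker {v γC γU : ℝ} (hC : γC ≠ 0) (hv : 1 + 2 * v * γC ≠ 0) :
    (N2Lv1 v γC γU (-1)).transpose.mulVec (Fv1.mulVec (hSharpAlt v γC)) ≠ 0 := by
  rw [hSharpAlt_defect]
  intro h
  have h0 : 8 * γC * (1 + 2 * v * γC) * (2 - γU) = 0 := by
    have := congrFun h 0; simpa only [Pi.smul_apply, smul_eq_mul, Matrix.cons_val_zero, Pi.zero_apply] using this
  have h1 : 8 * γC * (1 + 2 * v * γC) * (-(2 + γU)) = 0 := by
    have := congrFun h 1; simpa only [Pi.smul_apply, smul_eq_mul, Matrix.cons_val_one, Matrix.head_cons,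
      Matrix.cons_val_zero, Pi.zero_apply] using this
  have hne : 8 * γC * (1 + 2 * v * γC) ≠ 0 := mul_ne_zero (mul_ne_zero (by norm_num) hC) hv
  have e0 : 2 - γU = 0 := (mul_eq_zero.mp h0).resolve_left hne
  have e1 : -(2 + γU) = 0 := (mul_eq_zero.mp h1).resolve_left hne
  linarith

/-! ## 4. The "short computation" (H l.8046) -/

/-- Core identity: `⟨∂_λN_{v1}(2L̂(0),λ)|_{λ=−1}·(1+γU/2, 1−γU/2)ᵀ, F·(1+2(v−1)γC, 1+2(v+1)γC)ᵀ⟩ = −24(1+2vγC)`;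
the parameter `γU = γ^Υ` drops out identically. [cite: Hintz2026, proof of Lemma LemmaWE0Pair TeX l.8041-8046 (the "short computation", reproduced)] -/
theorem core_identity (v γC γU : ℝ) :
    dotProduct ((dN2Lv1 v γC γU (-1)).mulVec (hOne γU)) (Fv1.mulVec (hSharp v γC)) = -24 * (1 + 2 * v * γC) := by
  simp [dN2Lv1, hOne, hSharp, Fv1, Matrix.mulVec, dotProduct, Fin.sum_univ_two]
  ring

/-- The same contraction with the l.8044 vector: `γU`-DEPENDENT (so it cannot produce (EqWE0Pairv1)).
[cite: Hintz2026, TeX l.8044 (audit datum SRC-A37)] -/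
theorem core_identity_alt (v γC γU : ℝ) :
    dotProduct ((dN2Lv1 v γC γU (-1)).mulVec (hOne γU)) (Fv1.mulVec (hSharpAlt v γC)) =
      -(1 + 2 * v * γC) * (24 + 4 * γC * γU) := by
  simp [dN2Lv1, hOne, hSharpAlt, Fv1, Matrix.mulVec, dotProduct, Fin.sum_univ_two]
  ring

/-- The printed expression of H l.8041–8045, as a function of the pairing data: `T = ⟨𝔞(𝕍), 𝔞(b)×𝔞(𝕍′)⟩`, mass `𝔪`,
and the leading vectors `a` (of `ρ ū h¹`, WITH its `¼` written separately as printed) and `c` (of `ρ^{−2}ū h♯` without its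
prefactor); `∂_λN_{v1}(ρ^{−2}L̂(0),λ) = ½·dN2Lv1` since `N2Lv1` transcribes `2L̂(0)`.  READING (v2, audit datum SRC-A38 /
REFEREE #64 P29): the four printed factors `∂_λN|_{−1} · (1+γ^Υ/2, 1−γ^Υ/2) · F · c` are assembled HERE as GI Lemma 2.5
(eq. (2.8), case `k = 0`) prescribes and as the paper's parenthesis "(The form of this expression is a special case of
[GI, Lemma 2.5])" (H l.8046) says: `⟨∂_λN(x^αL,z)·u₀, F·v₀*⟩` with `u₀ = hOne` (kernel datum) and `v₀* = c` (cokernel datum) —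
NOT as the literal matrix product `hOneᵀ·∂_λN·F·c = ⟨(∂_λN)ᵀ hOne, F c⟩`, which differs (`∂_λN` is not symmetric) and does not
reproduce (EqWE0Pairv1) (`literalExpression`, `literal_reading_witness`).  "Transcription" is meant in this sense.
[cite: Hintz2026, proof of Lemma LemmaWE0Pair, display TeX l.8041-8045 (transcription, GI-Lemma-2.5 reading);
Hintz2023GluingI, Lemma 2.5 `LemmaBgBdyPair` TeX l.1689-1711, eq. (2.8) `EqBgBdyPair` l.1702-1709 (k = 0 line l.1707; vector-bundle sentence l.1710)] -/
def printedExpression (𝔪 v γC γU T : ℝ) (c : Fin 2 → ℝ) : ℝ :=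
  -(8 * π / 3) * T * (1 / 4) * (-(𝔪 / (1 + 2 * v * γC))) *
    dotProduct (((1 / 2 : ℝ) • dN2Lv1 v γC γU (-1)).mulVec (hOne γU)) (Fv1.mulVec c)

/-- **"After a short computation, this gives (EqWE0Pairv1)"** (H l.8046) — TRUE with the (EqWC0hbv1Lead) vector:
the printed expression equals `−8π𝔪⟨𝔞(𝕍), 𝔞(b)×𝔞(𝕍′)⟩` for all `(𝔪, v, γC, γU)` with `1+2vγC ≠ 0`.
[cite: Hintz2026, eq. (EqWE0Pairv1) TeX l.7988-7991 and proof l.8041-8046 (reproduced)] -/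
theorem direct_computation (𝔪 v γC γU T : ℝ) (h : 1 + 2 * v * γC ≠ 0) :
    printedExpression 𝔪 v γC γU T (hSharp v γC) = -8 * π * 𝔪 * T := by
  have key : dotProduct (((1 / 2 : ℝ) • dN2Lv1 v γC γU (-1)).mulVec (hOne γU)) (Fv1.mulVec (hSharp v γC)) =
      -12 * (1 + 2 * v * γC) := by
    rw [Matrix.smul_mulVec, smul_dotProduct, core_identity, smul_eq_mul]; ring
  unfold printedExpression
  rw [key]
  field_simp
  ring

/-- With the l.8044 vector the printed expression is `−8π𝔪T·(1 + γ^𝓒γ^Υ/6)` — `γU`-dependent, so it cannot give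
(EqWE0Pairv1) unless `γCγU = 0`; the operative vector is (EqWC0hbv1Lead)'s (`direct_computation`).
[cite: Hintz2026, TeX l.8044 vs eq. (EqWE0Pairv1) l.7988-7991 (audit datum SRC-A37)] -/
theorem direct_computation_alt (𝔪 v γC γU T : ℝ) (h : 1 + 2 * v * γC ≠ 0) :
    printedExpression 𝔪 v γC γU T (hSharpAlt v γC) = -8 * π * 𝔪 * T * (1 + γC * γU / 6) := by
  have key : dotProduct (((1 / 2 : ℝ) • dN2Lv1 v γC γU (-1)).mulVec (hOne γU)) (Fv1.mulVec (hSharpAlt v γC)) =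
      -(1 + 2 * v * γC) * (12 + 2 * γC * γU) := by
    rw [Matrix.smul_mulVec, smul_dotProduct, core_identity_alt, smul_eq_mul]; ring
  unfold printedExpression
  rw [key]
  field_simp
  ring

/-! ## 4b. The OTHER reading of the display (audit datum SRC-A38, REFEREE #64 precision P29): literal token order -/

/-- The literal matrix-product reading of the l.8041–8045 display, `row(u₀) · ∂_λN|_{−1} · F · column(v₀*) = ⟨(∂_λN)ᵀu₀, F v₀*⟩`
(transpose on the kernel side), in closed form: `−24(1+2vγC) + 8(γC+γU)(γU − 4γC + 2vγCγU)` — it DEPENDS on `γU`, unlike the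
GI-Lemma-2.5 reading `core_identity`. [cite: Hintz2026, proof of Lemma LemmaWE0Pair, display TeX l.8041-8045 (audit datum SRC-A38: the literal order, computed)] -/
theorem core_identity_literal (v γC γU : ℝ) :
    dotProduct (hOne γU) ((dN2Lv1 v γC γU (-1)).mulVec (Fv1.mulVec (hSharp v γC))) =
      -24 * (1 + 2 * v * γC) + 8 * (γC + γU) * (γU - 4 * γC + 2 * v * γC * γU) := by
  simp [dN2Lv1, hOne, hSharp, Fv1, Matrix.mulVec, dotProduct, Fin.sum_univ_two]
  ring

/-- The two readings differ by `8(γC+γU)(γU − 4γC + 2vγCγU)`, which vanishes only on a proper algebraic subset of the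
parameters (e.g. NOT at `(0,1,1)`). [cite: Hintz2026, TeX l.8041-8046 (audit datum SRC-A38)] -/
theorem literal_sub_lemma25 (v γC γU : ℝ) :
    dotProduct (hOne γU) ((dN2Lv1 v γC γU (-1)).mulVec (Fv1.mulVec (hSharp v γC)))
      - dotProduct ((dN2Lv1 v γC γU (-1)).mulVec (hOne γU)) (Fv1.mulVec (hSharp v γC)) =
      8 * (γC + γU) * (γU - 4 * γC + 2 * v * γC * γU) := by
  rw [core_identity_literal, core_identity]; ring

/-- WITNESS (REFEREE #64's hand case): at `(v^𝓒, γ^𝓒, γ^Υ) = (0, 1, 1)` the GI-Lemma-2.5 core is `−24` and the literal-order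
core is `−72`. [cite: Hintz2026, TeX l.8041-8046 (audit datum SRC-A38)] -/
theorem literal_reading_witness :
    dotProduct ((dN2Lv1 0 1 1 (-1)).mulVec (hOne 1)) (Fv1.mulVec (hSharp 0 1)) = -24 ∧
      dotProduct (hOne 1) ((dN2Lv1 0 1 1 (-1)).mulVec (Fv1.mulVec (hSharp 0 1))) = -72 := by
  rw [core_identity, core_identity_literal]; norm_num

/-- The display in the literal reading, with the same printed prefactors as `printedExpression`.
[cite: Hintz2026, display TeX l.8041-8045 (audit datum SRC-A38: literal token order)] -/
def literalExpression (𝔪 v γC γU T : ℝ) (c : Fin 2 → ℝ) : ℝ :=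
  -(8 * π / 3) * T * (1 / 4) * (-(𝔪 / (1 + 2 * v * γC))) *
    dotProduct (hOne γU) (((1 / 2 : ℝ) • dN2Lv1 v γC γU (-1)).mulVec (Fv1.mulVec c))

/-- At the witness parameters the literal reading gives `−24π𝔪T`, three times (EqWE0Pairv1)'s `−8π𝔪T`; so whenever `𝔪T ≠ 0`
it does NOT give (EqWE0Pairv1) — the reading that does is GI Lemma 2.5's (`direct_computation`). [cite: Hintz2026, eq. (EqWE0Pairv1) TeX l.7988-7991 vs display l.8041-8045 (audit datum SRC-A38)] -/
theorem literalExpression_witness (𝔪 T : ℝ) :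
    literalExpression 𝔪 0 1 1 T (hSharp 0 1) = -24 * π * 𝔪 * T ∧
      (𝔪 * T ≠ 0 → literalExpression 𝔪 0 1 1 T (hSharp 0 1) ≠ -8 * π * 𝔪 * T) := by
  have key : dotProduct (hOne 1) (((1 / 2 : ℝ) • dN2Lv1 0 1 1 (-1)).mulVec (Fv1.mulVec (hSharp 0 1))) = -36 := by
    rw [Matrix.smul_mulVec, dotProduct_smul, literal_reading_witness.2, smul_eq_mul]; norm_num
  have hval : literalExpression 𝔪 0 1 1 T (hSharp 0 1) = -24 * π * 𝔪 * T := by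
    unfold literalExpression
    rw [key]
    ring
  refine ⟨hval, fun h hcontra => ?_⟩
  rw [hval] at hcontra
  have : 16 * π * (𝔪 * T) = 0 := by linarith
  rcases mul_eq_zero.mp this with h16 | hmt
  · exact Real.pi_ne_zero (by linarith)
  · exact h hmt

/-! ## 5. The two arguments agree; the GI / GIII–Hintz tables side by side -/

/-- CONCEPTUAL = DIRECT: `½ · (−16π𝔪 q) = −8π𝔪 q` — Lemma 8.12's imported value `−16π𝔪(𝔮·ȧ)` times the `½` of
(EqWEMode0Ang) equals the value certified in `direct_computation` (with `q = ⟨𝔞(𝕍′), v×𝔞⟩ = T` by cyclicity).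
[cite: Hintz2026, TeX l.8005-8011 (conceptual argument) vs l.8041-8046 (direct)] -/
theorem conceptual_eq_direct (𝔪 q : ℝ) : (1 / 2 : ℝ) * (-16 * π * 𝔪 * q) = -8 * π * 𝔪 * q := by ring

/-- GI Theorem 9.6 (`ThmAhKCoker`), the printed table (GI l.4934–4946; public PDF p.129): rows `(𝔪̇,0)`, `(0,ȧ)`, `ĉ`;
columns `𝖦δ*dt̂`, `𝖦δ*(r̂²𝕍(𝔮))`, `𝖦δ*(d̸(r̂𝖲(𝔮)))`; entries as functions of `(𝔪, 𝔪̇, 𝔮·𝔞, 𝔮·ȧ, 𝔮·ĉ)`.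
[cite: Hintz2023GluingI, Thm 9.6 `ThmAhKCoker` table (transcription; preprint)] -/
def giThm96 (𝔪 dm qa qda qc : ℝ) : Matrix (Fin 3) (Fin 3) ℝ :=
  !![-8 * π * dm, -8 * π * qa * dm, 0;
     0, -8 * π * 𝔪 * qda, 0;
     0, 0, 4 * π * 𝔪 * qc]

/-- Hintz 2026 Lemma 8.12 (`LemmaWEPair`, H l.7887–7912) = GIII Lemma 3.17: the nine pairings
`⟨[L_b,t_*]ġ^Υ_b(𝔪̇,0) / ġ^Υ_b(0,ȧ) / (½[[L_b,t_*],t_*]h_{b,s1}(𝖲(c)) + [L_b,t_*]h̆¹_{b,s1}(𝖲(c))), h*⟩` against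
`h*_{b,s0}, h*_{b,v1}(𝕍(𝔮)), h*_{b,s1}(𝖲(𝔮))`. [cite: Hintz2026, Lemma LemmaWEPair, TeX l.7887-7912 (transcription; claim under review)] -/
def hLemma812 (𝔪 dm qa qda qc : ℝ) : Matrix (Fin 3) (Fin 3) ℝ :=
  !![-16 * π * dm, -16 * π * qa * dm, 0;
     0, -16 * π * 𝔪 * qda, 0;
     0, 0, 8 * π * 𝔪 * qc]

/-- Entry by entry, Hintz/GIII = 2 × GI (GIII's proof, arXiv:2408.06715 p.37: "We may thus replace `L` by `2D_{ĝ_b}Ric`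
… The pairings of interest are thus equal to twice [those of GI Thm 9.6]"). Datum only.
[cite: Hintz2024GluingIII, proof of Lemma 3.17, p.37; Hintz2023GluingI, Thm 9.6; Hintz2026, Lemma LemmaWEPair l.7887-7912] -/
theorem hLemma812_eq_two_smul_giThm96 (𝔪 dm qa qda qc : ℝ) :
    hLemma812 𝔪 dm qa qda qc = (2 : ℝ) • giThm96 𝔪 dm qa qda qc := by
  ext i j
  fin_cases i <;> fin_cases j <;> simp [hLemma812, giThm96] <;> ring

/-- Non-degeneracy is insensitive to the overall factor: both tables are triangular with determinant
`c·𝔪̇·𝔪²·(𝔮·ȧ)(𝔮·ĉ)` (`c = 256π³`, resp. `2048π³`). [cite: Hintz2023GluingI, Thm 9.6 table; Hintz2026, Lemma LemmaWEPair (arithmetic on the transcriptions)] -/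
theorem det_tables (𝔪 dm qa qda qc : ℝ) :
    (giThm96 𝔪 dm qa qda qc).det = 256 * π ^ 3 * dm * 𝔪 ^ 2 * qda * qc ∧
      (hLemma812 𝔪 dm qa qda qc).det = 2048 * π ^ 3 * dm * 𝔪 ^ 2 * qda * qc := by
  constructor
  · simp [giThm96, Matrix.det_fin_three]; ring
  · simp [hLemma812, Matrix.det_fin_three]; ring

/-! ## 6. GI (6.1)'s worked example = Hintz's (EqWC0VV) at the height function

GI, after (6.1) (GI l.3040–3041): "for `𝕍 = ∂_φ^♭ = sin²θ dφ`, one finds `𝕍⊗_s𝕍 = ⅓g̸ + (Y g̸ + δ̸₀*d̸Y)` where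
`Y = ½sin²θ − ⅓ ∈ 𝐒₂`."  Hintz (EqWC0VV) (H l.7120–7124): for `𝕍 = 𝕍(𝖲) ∈ 𝐕₁` on the unit sphere,
`𝕍⊗_s𝕍 = ((1/4π)∫𝖲²) g̸ + (Y(𝖲)g̸ + δ̸₀*d̸Y(𝖲))`, `Y(𝖲) := ½((1/4π)∫𝖲² − 𝖲²)`.  With `𝖲 = cos θ` (so `𝕍(𝖲) = 𝕍(e_z) =
sin²θ dφ` on the unit sphere, Def. `DefTYs1` H l.3219–3222): `(1/4π)∫cos² = ⅓` and `Y(cos θ) = ½(⅓ − cos²θ) = ½sin²θ − ⅓`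
— GI's `Y`.  Components (round metric `g̸ = dθ² + sin²θdφ²`, `Γ^θ_{φφ} = −sinθcosθ`, `Γ^φ_{θφ} = cotθ`; `δ̸₀*d̸Y` = trace-free
Hessian): `θθ`: `⅓ + Y + (Y″ − ½(Y″ + cotθ·Y′)) = 0 = (𝕍⊗𝕍)_{θθ}`; `φφ`: `⅓sin²θ + Y sin²θ + (sinθcosθ·Y′ − ½(Y″ +
cotθ·Y′)sin²θ) = sin⁴θ = (𝕍⊗𝕍)_{φφ}`; `θφ`: both sides `0`. -/

/-- GI's `Y(θ) = ½ sin²θ − ⅓`. [cite: Hintz2023GluingI, example after eq. (6.1), TeX l.3040-3041] -/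
def Y (θ : ℝ) : ℝ := 1 / 2 * sin θ ^ 2 - 1 / 3
/-- `Y′(θ) = sinθ cosθ` (elementary calculus). [folklore] -/
def Y' (θ : ℝ) : ℝ := sin θ * cos θ
/-- `Y″(θ) = cos²θ − sin²θ` (elementary calculus). [folklore] -/
def Y'' (θ : ℝ) : ℝ := cos θ ^ 2 - sin θ ^ 2

/-- `Y′` is the derivative of `Y`. [folklore] -/
theorem hasDerivAt_Y (θ : ℝ) : HasDerivAt Y (Y' θ) θ := by
  unfold Y Y'
  have h := (((Real.hasDerivAt_sin θ).pow 2).const_mul (1 / 2 : ℝ)).sub_const (1 / 3 : ℝ)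
  refine h.congr_deriv ?_
  norm_num
  ring

/-- `Y″` is the derivative of `Y′`. [folklore] -/
theorem hasDerivAt_Y' (θ : ℝ) : HasDerivAt Y' (Y'' θ) θ := by
  unfold Y' Y''
  have h := (Real.hasDerivAt_sin θ).mul (Real.hasDerivAt_cos θ)
  refine h.congr_deriv ?_
  ring

/-- Hintz's `Y(𝖲)` at `𝖲 = cos θ` with `avg 𝖲² = ⅓` is GI's `Y`. [cite: Hintz2026, eq. (EqWC0VV) TeX l.7120-7124; Hintz2023GluingI, TeX l.3040-3041] -/
theorem hintzY_eq_giY (θ : ℝ) : (1 / 2 : ℝ) * (1 / 3 - cos θ ^ 2) = Y θ := by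
  unfold Y; nlinarith [sin_sq_add_cos_sq θ]

/-- `∫₀^π cos²θ sinθ dθ = 2/3` (elementary calculus). [folklore] -/
theorem integral_cos_sq_mul_sin : ∫ θ in (0:ℝ)..π, cos θ ^ 2 * sin θ = 2 / 3 := by
  have hderiv : ∀ x ∈ Set.uIcc (0:ℝ) π, HasDerivAt (fun θ => -(cos θ ^ 3) / 3) (cos x ^ 2 * sin x) x := by
    intro x _
    have h := (((Real.hasDerivAt_cos x).pow 3).neg).div_const 3
    refine h.congr_deriv ?_
    norm_num
    ring
  have hcont : Continuous fun θ : ℝ => cos θ ^ 2 * sin θ := by fun_prop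
  rw [intervalIntegral.integral_eq_sub_of_hasDerivAt hderiv (hcont.intervalIntegrable _ _)]
  simp
  norm_num

/-- The sphere average of the squared height function: `(1/4π)·2π·∫₀^π cos²θ sinθ dθ = ⅓` — the `⅓g̸` of GI's example and
the `(1/4π)∫𝖲²` of (EqWC0VV) at `𝖲 = cos θ` (cf. GI Example 6.3: `(1/4π)∫ω^jω^l = δ^{jl}/3`).
[cite: Hintz2023GluingI, Example 6.3 `ExMkYProj` and the example after (6.1)] -/
theorem sphereAvg_heightSq : 1 / (4 * π) * (2 * π * ∫ θ in (0:ℝ)..π, cos θ ^ 2 * sin θ) = 1 / 3 := by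
  rw [integral_cos_sq_mul_sin]
  have hπ : π ≠ 0 := Real.pi_ne_zero
  field_simp
  ring

/-- **(EqWC0VV) at `𝖲 = cos θ` = GI's example**, componentwise on `sin θ ≠ 0`: `θθ` and `φφ` components of
`𝕍⊗_s𝕍 = ⅓g̸ + Y g̸ + (Hess Y − ½(tr Hess Y) g̸)` for `𝕍 = sin²θ dφ`, with `Hess_{θθ} = Y″`, `Hess_{φφ} = sinθcosθ·Y′`,
`tr Hess = Y″ + cotθ·Y′`. [cite: Hintz2023GluingI, example after eq. (6.1), TeX l.3040-3041; Hintz2026, eq. (EqWC0VV) TeX l.7120-7124 (instance reproduced)] -/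
theorem eqWC0VV_at_height (θ : ℝ) (hs : sin θ ≠ 0) :
    -- θθ component: (𝕍⊗𝕍)_{θθ} = 0
    (1 / 3 : ℝ) * 1 + Y θ * 1 + (Y'' θ - 1 / 2 * (Y'' θ + cos θ / sin θ * Y' θ) * 1) = 0 ∧
    -- φφ component: (𝕍⊗𝕍)_{φφ} = sin⁴θ
    (1 / 3 : ℝ) * sin θ ^ 2 + Y θ * sin θ ^ 2
        + (sin θ * cos θ * Y' θ - 1 / 2 * (Y'' θ + cos θ / sin θ * Y' θ) * sin θ ^ 2) = sin θ ^ 4 := by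
  have h1 := sin_sq_add_cos_sq θ
  constructor
  · unfold Y Y' Y''
    field_simp
    nlinarith [h1]
  · unfold Y Y' Y''
    field_simp
    nlinarith [h1]

end Literature.Geometry.Lorentzian.Hintz2026.VectorTypeOnePairing

end
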